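import Mathlib
import HarnessLib
import Literature.Computability.AlgebraicComplexity.BCGPUInfiniteGroupsProofs
import Summits.MatrixMultiplication.MatrixMultiplication.Theses.OrbitHarmonicsHosts

/-!
# Route OrbitHarmonicsHosts — `HostingRestriction` (item stmt-MatrixMultiplication-5459)

A hosting identity `γ (α X * β Y) = X * Y` for linear maps `α, β : M_N(ℂ) → A`, `γ : A → M_N(ℂ)`
into a commutative `ℂ`-algebra `A` with a finite basis `b` exhibits the matrix multiplication tensor
`⟨N, N, N⟩` as a restriction of the structure tensor of `A` in the basis `b`
(Bürgisser–Clausen–Shokrollahi 1997, §14.2; Bläser 2013, §4–5).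

Proof: the tree's `tensorRestrictsTo_structureTensor_of_factors` (a bilinear map computed inside an
algebra with a finite basis is a restriction of its structure tensor) applied to the vectors
`α (E_{κμ})`, `β (E_{μ'ν'})` and the linear forms `Z ↦ (γ Z)_{κν}`; what is left is the index
bookkeeping `⟨N,N,N⟩_{(κ,ν),(κ',μ),(μ',ν')} = (E_{κ'μ} E_{μ'ν'})_{κν}` (output index first in both
`matMulTensor` and `structureTensor`). Commutativity of `A` is not used.
-/

-- single-conjunct summit: the `Summit.<S>.<P>` prefix repeats `MatrixMultiplication` by design (D-0017)
set_option linter.dupNamespace false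

namespace Summit.MatrixMultiplication.MatrixMultiplication.Theorems

open Literature.Computability.AlgebraicComplexity

/-- Index bookkeeping: the entry `⟨N,N,N⟩_{r,p,q}` of the matrix multiplication tensor (output index
`r = (κ, ν)` first, then the `X`-variable `p = (κ', μ)` and the `Y`-variable `q = (μ', ν')`) is the
`(κ, ν)` entry of the product of matrix units `E_{κ'μ} · E_{μ'ν'}`. -/
theorem matMulTensor_eq_single_mul_single_apply (N : ℕ) (r p q : Fin N × Fin N) :
    matMulTensor ℂ N N N r p q =
      (Matrix.single p.1 p.2 (1 : ℂ) * Matrix.single q.1 q.2 (1 : ℂ)) r.1 r.2 := by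
  obtain ⟨r₁, r₂⟩ := r
  obtain ⟨p₁, p₂⟩ := p
  obtain ⟨q₁, q₂⟩ := q
  by_cases h₁ : r₁ = p₁
  · subst h₁
    rw [Matrix.single_mul_apply_same, one_mul, Matrix.single_apply]
    -- `[r₁ = r₁ ∧ p₂ = q₁ ∧ r₂ = q₂] = [q₁ = p₂ ∧ q₂ = r₂]`
    simp only [matMulTensor, true_and]
    exact if_congr ⟨fun h => ⟨h.1.symm, h.2.symm⟩, fun h => ⟨h.1.symm, h.2.symm⟩⟩ rfl rfl
  · rw [Matrix.single_mul_apply_of_ne _ _ _ _ _ h₁]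
    simp only [matMulTensor]
    rw [if_neg (fun h => h₁ h.1)]

/-- **`HostingRestriction`** (route OrbitHarmonicsHosts, item stmt-MatrixMultiplication-5459): a
hosting identity `γ (α X * β Y) = X * Y` in a commutative `ℂ`-algebra `A` with a finite basis `b`
exhibits `⟨N, N, N⟩` as a restriction of `structureTensor b` — the restriction matrices are the
`b`-coordinates of `α (E_{κμ})`, `β (E_{μν})` and the entries of `γ (b_z)`
(BCS 1997, §14.2; in tree as `tensorRestrictsTo_structureTensor_of_factors`). -/
theorem hostingRestriction_proof :
    Summit.MatrixMultiplication.MatrixMultiplication.Theses.OrbitHarmonicsHosts.HostingRestriction := by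
  intro A _ _ ι _ b N α β γ h
  refine tensorRestrictsTo_structureTensor_of_factors b
    (fun p : Fin N × Fin N => α (Matrix.single p.1 p.2 (1 : ℂ)))
    (fun q : Fin N × Fin N => β (Matrix.single q.1 q.2 (1 : ℂ)))
    (fun r : Fin N × Fin N => Matrix.entryLinearMap ℂ ℂ r.1 r.2 ∘ₗ γ) (matMulTensor ℂ N N N)
    fun r p q => ?_
  rw [LinearMap.comp_apply, Matrix.entryLinearMap_apply, h]
  exact matMulTensor_eq_single_mul_single_apply N r p q

end Summit.MatrixMultiplication.MatrixMultiplication.Theorems
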